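import Mathlib
import HarnessLib

/-!
# QUANT lane R8, front "FAR beyond trees", layer one — THE DEGREE-THREE GATE AT THE OBSERVER, XXXII: the 8-cell cover lemma for `p ≥ 1/3`

builds on p205010 (kernel theorem, internal audit signed; external expert review pending)

Support file (`--supports stmt-CriticalPhenomena-4575`), seat `prim-quant-p1` (gen 30); memo
`run/shared/lean/prim/quant/prim-quant-p1-g30/FOR-LEAD-GATE3-RED8.md`.  Pure real algebra (Mathlib only); standard axioms; no sorries; no definitions.
GENERATED by `work/gen_third.py` (the Handelman certificate of `G_third` is found by an exact LP, `num/handelman.py`).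

THE FIRST UNCONDITIONAL PARAMETER RANGE OF THE GENERAL GATE.  In the clean 8-cell bad-form statement (hypothesis `h8` of `Gate3.red_of_red8`,
file XXX) every parameter point with `1/3 ≤ p ≤ 1`, `r₁, r₂ ∈ [0,1]`, `nn ≥ 1` is covered by HARRIS-FREE linear certificates:
* `red8_edge`: `r₁ = 1 ∨ r₂ = 1 ∨ p = 1` (then `g₁ ≤ 0`, `g₂ ≤ 0` or `g₁ ≤ 0`);
* `red8_coupled`: `Δ := (1−p)² − s₁s₂ ≤ 0` (`sᵢ = 1 − (1−p)(1−rᵢ)`): `s₁(1−r₂)·g₁ + (1−p)(1−r₁)·g₂ ≤ 0` coefficientwise (g28's coupled regime);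
* `red8_crowdplus` (witness form) / `red8_crowdplus_star` (closed form, `Δ > 0`): `g_S + l₁g₁ + l₂g₂ ≤ 0` with `lᵢ = nn·sᵢmᵢ/((1−rᵢ)Δ)`,
  valid iff (A*) `κ_a·Δ ≤ p·nn·(s₁m₁ + s₂m₂)` and (C*) `κ_c·Δ ≤ p·nn·((1−r₂)s₁m₁ + (1−r₁)s₂m₂)` (g29's crowd-plus, file XXIa, restated at the 8-cell level);
* `G_third`: for `p ≥ 1/3`: `(1−p)·Δ ≤ p·((1−r₂)s₁m₁ + (1−r₁)s₂m₂)` — a degree-7 polynomial inequality on the box, tight exactly at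
  `(p, r₁, r₂) = (1/3, 0, 0)`, proved by an explicit 21-term Handelman certificate; with `κ_a, κ_c ≤ 1 − p` (`nn ≥ 1`) it gives (A*) and (C*).
Hence `red8_third`: the 8-cell cover lemma for all `p ∈ [1/3, 1]`, `r₁, r₂ ∈ [0,1]`, `nn ≥ 1` — and through files XXX, XXIV, XX the layer-one row
at every degree-three gate with `p ≥ 1/3`, on every finite weighted graph.  Numerically `1/3` is sharp for crowd-plus (at `r = 0`, `nn = 1`); below
`1/3` the M-mechanism (`W·E + (nn+1−W)·g_v + λ·g_S`) and then the Harris rows take over (memo).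
[cite: KozmaNitzan2024, Conjecture 3 (p. 15)]; [cite: Grimmett1999, §2.2, Thm. (2.4) p. 34]; [this work].
-/

noncomputable section

namespace Summit.CriticalPhenomena.PercolationContinuityZ3.Theorems

namespace Quant

namespace Gate3

/-- **Degenerate edges**: if `r₁ = 1`, `r₂ = 1` or `p = 1` the 8-cell bad set is empty (`g₁ ≤ 0` or `g₂ ≤ 0`). [this work] -/
theorem red8_edge (p r₁ r₂ nn : ℝ) (hp0 : 0 ≤ p) (hp1 : p ≤ 1) (hr10 : 0 ≤ r₁) (hr11 : r₁ ≤ 1) (hr20 : 0 ≤ r₂) (hr21 : r₂ ≤ 1)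
    (h : r₁ = 1 ∨ r₂ = 1 ∨ p = 1) :
    ∀ (a0 a1 a2 b1 b2 c0 c1 d : ℝ), 0 ≤ a0 → 0 ≤ a1 → 0 ≤ a2 → 0 ≤ b1 → 0 ≤ b2 → 0 ≤ c0 → 0 ≤ c1 → 0 ≤ d →
      b1 * (b2 + (c0 + c1)) ≤ (a0 + a1 + a2) * d →
      b2 * (b1 + (c0 + c1)) ≤ (a0 + a1 + a2) * d →
      (c0 + c1) * (b1 + b2) ≤ (a0 + a1 + a2) * d →
      b1 * (a1 + a2 + c1 + d) ≤ d * (a0 + b1 + b2 + c0) →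
      b2 * (a1 + a2 + c1 + d) ≤ d * (a0 + b1 + b2 + c0) →
      c0 * (a1 + a2 + c1 + d) ≤ (c1 + d) * (a0 + b1 + b2 + c0) →
      0 < p * ((1 - r₁) * (1 - r₂)) * (a0 + c0) - (1 - p) * a2 - (1 - p) * ((1 - r₁) * (1 - r₂)) * d →
      0 < (1 - p) * (1 - r₁) * b1 - p * (r₂ * (1 - r₁)) * a0 - p * (1 - r₁) * a1 - (1 - p * r₁) * a2 - (1 - (1 - p) * (1 - r₂)) * (1 - r₁) * b2 - p * ((1 - r₁) * (1 - r₂)) * c1 →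
      0 < (1 - p) * (1 - r₂) * b2 - p * (r₁ * (1 - r₂)) * a0 - p * (1 - r₂) * a1 - (1 - p * r₂) * a2 - (1 - (1 - p) * (1 - r₁)) * (1 - r₂) * b1 - p * ((1 - r₁) * (1 - r₂)) * c1 →
      0 < (1 - p * max r₁ r₂ - nn * p * (1 - max r₁ r₂)) * a1 + (1 - p * (r₁ + r₂ * (1 - r₁)) - nn * p * ((1 - r₁) * (1 - r₂))) * c1 - nn * p * (r₁ + r₂ * (1 - r₁) - max r₁ r₂) * a0 - nn * ((1 - (1 - p) * (1 - r₁)) * (1 - r₂)) * b1 - nn * ((1 - (1 - p) * (1 - r₂)) * (1 - r₁)) * b2 →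
      0 < (p * (1 + r₁ + r₂ + nn * max r₁ r₂) - 2) * a0 + (p * (1 + r₁ + r₂) + p * max r₁ r₂ * (nn - 1) - 1) * a1 + (p * (1 + r₁ + r₂) + nn - 2) * a2 + ((1 - (1 - p) * (1 - r₁)) * (1 + r₂ * (nn + 1)) - 1) * b1 + ((1 - (1 - p) * (1 - r₂)) * (1 + r₁ * (nn + 1)) - 1) * b2 + (p * (1 + (nn + 2) * (r₁ + r₂ * (1 - r₁))) - 2) * c0 + (p * (1 + (nn + 1) * (r₁ + r₂ * (1 - r₁))) - 1) * c1 + (nn + 1 - (1 - p) * ((1 - r₁) * (1 - r₂))) * d →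
      False := by
  intro a0 a1 a2 b1 b2 c0 c1 d ha0 ha1 ha2 hb1 hb2 hc0 hc1 hd hU1 hU2 hU3 hK1 hK2 hK3 hV hG1 hG2 hS hE
  have hs1 : 0 ≤ 1 - (1 - p) * (1 - r₁) := by nlinarith only [hp0, hp1, hr10, hr11]
  have hs2 : 0 ≤ 1 - (1 - p) * (1 - r₂) := by nlinarith only [hp0, hp1, hr20, hr21]
  have hpr1 : p * r₁ ≤ 1 := by nlinarith only [hp0, hp1, hr10, hr11]
  have hpr2 : p * r₂ ≤ 1 := by nlinarith only [hp0, hp1, hr20, hr21]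
  have t1 : 0 ≤ p * (r₂ * (1 - r₁)) * a0 := mul_nonneg (mul_nonneg hp0 (mul_nonneg hr20 (sub_nonneg.2 hr11))) ha0
  have t2 : 0 ≤ p * (1 - r₁) * a1 := mul_nonneg (mul_nonneg hp0 (sub_nonneg.2 hr11)) ha1
  have t3 : 0 ≤ (1 - p * r₁) * a2 := mul_nonneg (sub_nonneg.2 hpr1) ha2
  have t4 : 0 ≤ (1 - (1 - p) * (1 - r₂)) * (1 - r₁) * b2 := mul_nonneg (mul_nonneg hs2 (sub_nonneg.2 hr11)) hb2
  have t5 : 0 ≤ p * ((1 - r₁) * (1 - r₂)) * c1 := mul_nonneg (mul_nonneg hp0 (mul_nonneg (sub_nonneg.2 hr11) (sub_nonneg.2 hr21))) hc1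
  have u1 : 0 ≤ p * (r₁ * (1 - r₂)) * a0 := mul_nonneg (mul_nonneg hp0 (mul_nonneg hr10 (sub_nonneg.2 hr21))) ha0
  have u2 : 0 ≤ p * (1 - r₂) * a1 := mul_nonneg (mul_nonneg hp0 (sub_nonneg.2 hr21)) ha1
  have u3 : 0 ≤ (1 - p * r₂) * a2 := mul_nonneg (sub_nonneg.2 hpr2) ha2
  have u4 : 0 ≤ (1 - (1 - p) * (1 - r₁)) * (1 - r₂) * b1 := mul_nonneg (mul_nonneg hs1 (sub_nonneg.2 hr21)) hb1
  rcases h with h | h | h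
  · have e : (1 - p) * (1 - r₁) * b1 = 0 := by rw [h]; ring
    linarith only [hG1, e, t1, t2, t3, t4, t5]
  · have e : (1 - p) * (1 - r₂) * b2 = 0 := by rw [h]; ring
    linarith only [hG2, e, u1, u2, u3, u4, t5]
  · have e : (1 - p) * (1 - r₁) * b1 = 0 := by rw [h]; ring
    linarith only [hG1, e, t1, t2, t3, t4, t5]

/-- **Coupled regime** `(1−p)² ≤ s₁s₂` (g28, file IV, restated at the 8-cell level): `s₁(1−r₂)·g₁ + (1−p)(1−r₁)·g₂ ≤ 0` coefficientwise. [this work] -/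
theorem red8_coupled (p r₁ r₂ nn : ℝ) (hp0 : 0 ≤ p) (hp1 : p < 1) (hr10 : 0 ≤ r₁) (hr11 : r₁ < 1) (hr20 : 0 ≤ r₂) (hr21 : r₂ ≤ 1)
    (hD : ((1 - p) ^ 2 - (1 - (1 - p) * (1 - r₁)) * (1 - (1 - p) * (1 - r₂))) ≤ 0) :
    ∀ (a0 a1 a2 b1 b2 c0 c1 d : ℝ), 0 ≤ a0 → 0 ≤ a1 → 0 ≤ a2 → 0 ≤ b1 → 0 ≤ b2 → 0 ≤ c0 → 0 ≤ c1 → 0 ≤ d →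
      b1 * (b2 + (c0 + c1)) ≤ (a0 + a1 + a2) * d →
      b2 * (b1 + (c0 + c1)) ≤ (a0 + a1 + a2) * d →
      (c0 + c1) * (b1 + b2) ≤ (a0 + a1 + a2) * d →
      b1 * (a1 + a2 + c1 + d) ≤ d * (a0 + b1 + b2 + c0) →
      b2 * (a1 + a2 + c1 + d) ≤ d * (a0 + b1 + b2 + c0) →
      c0 * (a1 + a2 + c1 + d) ≤ (c1 + d) * (a0 + b1 + b2 + c0) →
      0 < p * ((1 - r₁) * (1 - r₂)) * (a0 + c0) - (1 - p) * a2 - (1 - p) * ((1 - r₁) * (1 - r₂)) * d →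
      0 < (1 - p) * (1 - r₁) * b1 - p * (r₂ * (1 - r₁)) * a0 - p * (1 - r₁) * a1 - (1 - p * r₁) * a2 - (1 - (1 - p) * (1 - r₂)) * (1 - r₁) * b2 - p * ((1 - r₁) * (1 - r₂)) * c1 →
      0 < (1 - p) * (1 - r₂) * b2 - p * (r₁ * (1 - r₂)) * a0 - p * (1 - r₂) * a1 - (1 - p * r₂) * a2 - (1 - (1 - p) * (1 - r₁)) * (1 - r₂) * b1 - p * ((1 - r₁) * (1 - r₂)) * c1 →
      0 < (1 - p * max r₁ r₂ - nn * p * (1 - max r₁ r₂)) * a1 + (1 - p * (r₁ + r₂ * (1 - r₁)) - nn * p * ((1 - r₁) * (1 - r₂))) * c1 - nn * p * (r₁ + r₂ * (1 - r₁) - max r₁ r₂) * a0 - nn * ((1 - (1 - p) * (1 - r₁)) * (1 - r₂)) * b1 - nn * ((1 - (1 - p) * (1 - r₂)) * (1 - r₁)) * b2 →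
      0 < (p * (1 + r₁ + r₂ + nn * max r₁ r₂) - 2) * a0 + (p * (1 + r₁ + r₂) + p * max r₁ r₂ * (nn - 1) - 1) * a1 + (p * (1 + r₁ + r₂) + nn - 2) * a2 + ((1 - (1 - p) * (1 - r₁)) * (1 + r₂ * (nn + 1)) - 1) * b1 + ((1 - (1 - p) * (1 - r₂)) * (1 + r₁ * (nn + 1)) - 1) * b2 + (p * (1 + (nn + 2) * (r₁ + r₂ * (1 - r₁))) - 2) * c0 + (p * (1 + (nn + 1) * (r₁ + r₂ * (1 - r₁))) - 1) * c1 + (nn + 1 - (1 - p) * ((1 - r₁) * (1 - r₂))) * d →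
      False := by
  intro a0 a1 a2 b1 b2 c0 c1 d ha0 ha1 ha2 hb1 hb2 hc0 hc1 hd hU1 hU2 hU3 hK1 hK2 hK3 hV hG1 hG2 hS hE
  have hs1 : 0 ≤ 1 - (1 - p) * (1 - r₁) := by nlinarith only [hp0, hp1, hr10, hr11]
  have hs2 : 0 ≤ 1 - (1 - p) * (1 - r₂) := by nlinarith only [hp0, hp1, hr20, hr21]
  have hpr1 : p * r₁ ≤ 1 := by nlinarith only [hp0, hp1, hr10, hr11]
  have hpr2 : p * r₂ ≤ 1 := by nlinarith only [hp0, hp1, hr20, hr21]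
  have hm1 : 0 ≤ (1 - (1 - p) * (1 - r₁)) * (1 - r₂) := mul_nonneg hs1 (sub_nonneg.2 hr21)
  have hm2 : 0 < (1 - p) * (1 - r₁) := mul_pos (by linarith only [hp1]) (by linarith only [hr11])
  have hcomb : 0 < (1 - (1 - p) * (1 - r₁)) * (1 - r₂) * ((1 - p) * (1 - r₁) * b1 - p * (r₂ * (1 - r₁)) * a0 - p * (1 - r₁) * a1 - (1 - p * r₁) * a2 - (1 - (1 - p) * (1 - r₂)) * (1 - r₁) * b2 - p * ((1 - r₁) * (1 - r₂)) * c1) + (1 - p) * (1 - r₁) * ((1 - p) * (1 - r₂) * b2 - p * (r₁ * (1 - r₂)) * a0 - p * (1 - r₂) * a1 - (1 - p * r₂) * a2 - (1 - (1 - p) * (1 - r₁)) * (1 - r₂) * b1 - p * ((1 - r₁) * (1 - r₂)) * c1) :=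
    add_pos_of_nonneg_of_pos (mul_nonneg hm1 hG1.le) (mul_pos hm2 hG2)
  have key : (1 - (1 - p) * (1 - r₁)) * (1 - r₂) * ((1 - p) * (1 - r₁) * b1 - p * (r₂ * (1 - r₁)) * a0 - p * (1 - r₁) * a1 - (1 - p * r₁) * a2 - (1 - (1 - p) * (1 - r₂)) * (1 - r₁) * b2 - p * ((1 - r₁) * (1 - r₂)) * c1) + (1 - p) * (1 - r₁) * ((1 - p) * (1 - r₂) * b2 - p * (r₁ * (1 - r₂)) * a0 - p * (1 - r₂) * a1 - (1 - p * r₂) * a2 - (1 - (1 - p) * (1 - r₁)) * (1 - r₂) * b1 - p * ((1 - r₁) * (1 - r₂)) * c1)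
      = ((1 - p) ^ 2 - (1 - (1 - p) * (1 - r₁)) * (1 - (1 - p) * (1 - r₂))) * (((1 - r₁) * (1 - r₂)) * b2)
        - ((1 - (1 - p) * (1 - r₁)) * (1 - r₂) * (p * (r₂ * (1 - r₁))) + (1 - p) * (1 - r₁) * (p * (r₁ * (1 - r₂)))) * a0
        - ((1 - (1 - p) * (1 - r₁)) * (1 - r₂) * (p * (1 - r₁)) + (1 - p) * (1 - r₁) * (p * (1 - r₂))) * a1
        - ((1 - (1 - p) * (1 - r₁)) * (1 - r₂) * (1 - p * r₁) + (1 - p) * (1 - r₁) * (1 - p * r₂)) * a2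
        - ((1 - (1 - p) * (1 - r₁)) * (1 - r₂) + (1 - p) * (1 - r₁)) * (p * ((1 - r₁) * (1 - r₂))) * c1 := by ring
  have t0 : ((1 - p) ^ 2 - (1 - (1 - p) * (1 - r₁)) * (1 - (1 - p) * (1 - r₂))) * (((1 - r₁) * (1 - r₂)) * b2) ≤ 0 :=
    mul_nonpos_of_nonpos_of_nonneg hD (mul_nonneg (mul_nonneg (sub_nonneg.2 hr11.le) (sub_nonneg.2 hr21)) hb2)
  have t1 : 0 ≤ ((1 - (1 - p) * (1 - r₁)) * (1 - r₂) * (p * (r₂ * (1 - r₁))) + (1 - p) * (1 - r₁) * (p * (r₁ * (1 - r₂)))) * a0 :=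
    mul_nonneg (add_nonneg (mul_nonneg hm1 (mul_nonneg hp0 (mul_nonneg hr20 (sub_nonneg.2 hr11.le)))) (mul_nonneg hm2.le (mul_nonneg hp0 (mul_nonneg hr10 (sub_nonneg.2 hr21))))) ha0
  have t2 : 0 ≤ ((1 - (1 - p) * (1 - r₁)) * (1 - r₂) * (p * (1 - r₁)) + (1 - p) * (1 - r₁) * (p * (1 - r₂))) * a1 :=
    mul_nonneg (add_nonneg (mul_nonneg hm1 (mul_nonneg hp0 (sub_nonneg.2 hr11.le))) (mul_nonneg hm2.le (mul_nonneg hp0 (sub_nonneg.2 hr21)))) ha1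
  have t3 : 0 ≤ ((1 - (1 - p) * (1 - r₁)) * (1 - r₂) * (1 - p * r₁) + (1 - p) * (1 - r₁) * (1 - p * r₂)) * a2 :=
    mul_nonneg (add_nonneg (mul_nonneg hm1 (sub_nonneg.2 hpr1)) (mul_nonneg hm2.le (sub_nonneg.2 hpr2))) ha2
  have t4 : 0 ≤ ((1 - (1 - p) * (1 - r₁)) * (1 - r₂) + (1 - p) * (1 - r₁)) * (p * ((1 - r₁) * (1 - r₂))) * c1 :=
    mul_nonneg (mul_nonneg (add_nonneg hm1 hm2.le) (mul_nonneg hp0 (mul_nonneg (sub_nonneg.2 hr11.le) (sub_nonneg.2 hr21)))) hc1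
  linarith only [hcomb, key, t0, t1, t2, t3, t4]


/-- **Crowd-plus, witness form** (g29 file XXIa, restated at the 8-cell level): weights `l1, l2 ≥ 0` with the four cell conditions
(A) `κ_a ≤ p(l1(1−r₁) + l2(1−r₂))`, (C) `κ_c ≤ pW₁₂(l1 + l2)`, (B1) `l1(1−p)(1−r₁) ≤ (1−r₂)s₁(l2 + nn)`, (B2) mirror, make
`g_S + l1·g₁ + l2·g₂ ≤ 0` coefficientwise. [this work] -/
theorem red8_crowdplus (p r₁ r₂ nn l1 l2 : ℝ) (hp0 : 0 ≤ p) (hp1 : p ≤ 1) (hr10 : 0 ≤ r₁) (hr11 : r₁ ≤ 1) (hr20 : 0 ≤ r₂) (hr21 : r₂ ≤ 1)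
    (hn0 : 0 ≤ nn) (hl1 : 0 ≤ l1) (hl2 : 0 ≤ l2)
    (hA : (1 - p * max r₁ r₂ - nn * p * (1 - max r₁ r₂)) ≤ p * (l1 * (1 - r₁) + l2 * (1 - r₂)))
    (hC : (1 - p * (r₁ + r₂ * (1 - r₁)) - nn * p * ((1 - r₁) * (1 - r₂))) ≤ p * ((1 - r₁) * (1 - r₂)) * (l1 + l2))
    (hB1 : l1 * ((1 - p) * (1 - r₁)) ≤ (1 - r₂) * (1 - (1 - p) * (1 - r₁)) * (l2 + nn))
    (hB2 : l2 * ((1 - p) * (1 - r₂)) ≤ (1 - r₁) * (1 - (1 - p) * (1 - r₂)) * (l1 + nn)) :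
    ∀ (a0 a1 a2 b1 b2 c0 c1 d : ℝ), 0 ≤ a0 → 0 ≤ a1 → 0 ≤ a2 → 0 ≤ b1 → 0 ≤ b2 → 0 ≤ c0 → 0 ≤ c1 → 0 ≤ d →
      b1 * (b2 + (c0 + c1)) ≤ (a0 + a1 + a2) * d →
      b2 * (b1 + (c0 + c1)) ≤ (a0 + a1 + a2) * d →
      (c0 + c1) * (b1 + b2) ≤ (a0 + a1 + a2) * d →
      b1 * (a1 + a2 + c1 + d) ≤ d * (a0 + b1 + b2 + c0) →
      b2 * (a1 + a2 + c1 + d) ≤ d * (a0 + b1 + b2 + c0) →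
      c0 * (a1 + a2 + c1 + d) ≤ (c1 + d) * (a0 + b1 + b2 + c0) →
      0 < p * ((1 - r₁) * (1 - r₂)) * (a0 + c0) - (1 - p) * a2 - (1 - p) * ((1 - r₁) * (1 - r₂)) * d →
      0 < (1 - p) * (1 - r₁) * b1 - p * (r₂ * (1 - r₁)) * a0 - p * (1 - r₁) * a1 - (1 - p * r₁) * a2 - (1 - (1 - p) * (1 - r₂)) * (1 - r₁) * b2 - p * ((1 - r₁) * (1 - r₂)) * c1 →
      0 < (1 - p) * (1 - r₂) * b2 - p * (r₁ * (1 - r₂)) * a0 - p * (1 - r₂) * a1 - (1 - p * r₂) * a2 - (1 - (1 - p) * (1 - r₁)) * (1 - r₂) * b1 - p * ((1 - r₁) * (1 - r₂)) * c1 →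
      0 < (1 - p * max r₁ r₂ - nn * p * (1 - max r₁ r₂)) * a1 + (1 - p * (r₁ + r₂ * (1 - r₁)) - nn * p * ((1 - r₁) * (1 - r₂))) * c1 - nn * p * (r₁ + r₂ * (1 - r₁) - max r₁ r₂) * a0 - nn * ((1 - (1 - p) * (1 - r₁)) * (1 - r₂)) * b1 - nn * ((1 - (1 - p) * (1 - r₂)) * (1 - r₁)) * b2 →
      0 < (p * (1 + r₁ + r₂ + nn * max r₁ r₂) - 2) * a0 + (p * (1 + r₁ + r₂) + p * max r₁ r₂ * (nn - 1) - 1) * a1 + (p * (1 + r₁ + r₂) + nn - 2) * a2 + ((1 - (1 - p) * (1 - r₁)) * (1 + r₂ * (nn + 1)) - 1) * b1 + ((1 - (1 - p) * (1 - r₂)) * (1 + r₁ * (nn + 1)) - 1) * b2 + (p * (1 + (nn + 2) * (r₁ + r₂ * (1 - r₁))) - 2) * c0 + (p * (1 + (nn + 1) * (r₁ + r₂ * (1 - r₁))) - 1) * c1 + (nn + 1 - (1 - p) * ((1 - r₁) * (1 - r₂))) * d →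
      False := by
  intro a0 a1 a2 b1 b2 c0 c1 d ha0 ha1 ha2 hb1 hb2 hc0 hc1 hd hU1 hU2 hU3 hK1 hK2 hK3 hV hG1 hG2 hS hE
  have hpr1 : p * r₁ ≤ 1 := by nlinarith only [hp0, hp1, hr10, hr11]
  have hpr2 : p * r₂ ≤ 1 := by nlinarith only [hp0, hp1, hr20, hr21]
  have hmx : r₁ + r₂ * (1 - r₁) - max r₁ r₂ = min r₁ r₂ * (1 - max r₁ r₂) := by
    rcases le_total r₁ r₂ with h | h
    · rw [max_eq_right h, min_eq_left h]; ring
    · rw [max_eq_left h, min_eq_right h]; ring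
  have hmn : 0 ≤ min r₁ r₂ * (1 - max r₁ r₂) := mul_nonneg (le_min hr10 hr20) (sub_nonneg.2 (max_le hr11 hr21))
  have hcomb : 0 < ((1 - p * max r₁ r₂ - nn * p * (1 - max r₁ r₂)) * a1 + (1 - p * (r₁ + r₂ * (1 - r₁)) - nn * p * ((1 - r₁) * (1 - r₂))) * c1 - nn * p * (r₁ + r₂ * (1 - r₁) - max r₁ r₂) * a0 - nn * ((1 - (1 - p) * (1 - r₁)) * (1 - r₂)) * b1 - nn * ((1 - (1 - p) * (1 - r₂)) * (1 - r₁)) * b2) + l1 * ((1 - p) * (1 - r₁) * b1 - p * (r₂ * (1 - r₁)) * a0 - p * (1 - r₁) * a1 - (1 - p * r₁) * a2 - (1 - (1 - p) * (1 - r₂)) * (1 - r₁) * b2 - p * ((1 - r₁) * (1 - r₂)) * c1) + l2 * ((1 - p) * (1 - r₂) * b2 - p * (r₁ * (1 - r₂)) * a0 - p * (1 - r₂) * a1 - (1 - p * r₂) * a2 - (1 - (1 - p) * (1 - r₁)) * (1 - r₂) * b1 - p * ((1 - r₁) * (1 - r₂)) * c1) := by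
    have w1 := mul_nonneg hl1 hG1.le
    have w2 := mul_nonneg hl2 hG2.le
    linarith only [hS, w1, w2]
  have key : ((1 - p * max r₁ r₂ - nn * p * (1 - max r₁ r₂)) * a1 + (1 - p * (r₁ + r₂ * (1 - r₁)) - nn * p * ((1 - r₁) * (1 - r₂))) * c1 - nn * p * (r₁ + r₂ * (1 - r₁) - max r₁ r₂) * a0 - nn * ((1 - (1 - p) * (1 - r₁)) * (1 - r₂)) * b1 - nn * ((1 - (1 - p) * (1 - r₂)) * (1 - r₁)) * b2) + l1 * ((1 - p) * (1 - r₁) * b1 - p * (r₂ * (1 - r₁)) * a0 - p * (1 - r₁) * a1 - (1 - p * r₁) * a2 - (1 - (1 - p) * (1 - r₂)) * (1 - r₁) * b2 - p * ((1 - r₁) * (1 - r₂)) * c1) + l2 * ((1 - p) * (1 - r₂) * b2 - p * (r₁ * (1 - r₂)) * a0 - p * (1 - r₂) * a1 - (1 - p * r₂) * a2 - (1 - (1 - p) * (1 - r₁)) * (1 - r₂) * b1 - p * ((1 - r₁) * (1 - r₂)) * c1)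
      = ((1 - p * max r₁ r₂ - nn * p * (1 - max r₁ r₂)) - p * (l1 * (1 - r₁) + l2 * (1 - r₂))) * a1
        + ((1 - p * (r₁ + r₂ * (1 - r₁)) - nn * p * ((1 - r₁) * (1 - r₂))) - p * ((1 - r₁) * (1 - r₂)) * (l1 + l2)) * c1
        + (l1 * ((1 - p) * (1 - r₁)) - (1 - r₂) * (1 - (1 - p) * (1 - r₁)) * (l2 + nn)) * b1
        + (l2 * ((1 - p) * (1 - r₂)) - (1 - r₁) * (1 - (1 - p) * (1 - r₂)) * (l1 + nn)) * b2
        - (nn * p * (r₁ + r₂ * (1 - r₁) - max r₁ r₂) + l1 * (p * (r₂ * (1 - r₁))) + l2 * (p * (r₁ * (1 - r₂)))) * a0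
        - (l1 * (1 - p * r₁) + l2 * (1 - p * r₂)) * a2 := by ring
  have t1 : ((1 - p * max r₁ r₂ - nn * p * (1 - max r₁ r₂)) - p * (l1 * (1 - r₁) + l2 * (1 - r₂))) * a1 ≤ 0 := mul_nonpos_of_nonpos_of_nonneg (by linarith only [hA]) ha1
  have t2 : ((1 - p * (r₁ + r₂ * (1 - r₁)) - nn * p * ((1 - r₁) * (1 - r₂))) - p * ((1 - r₁) * (1 - r₂)) * (l1 + l2)) * c1 ≤ 0 := mul_nonpos_of_nonpos_of_nonneg (by linarith only [hC]) hc1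
  have t3 : (l1 * ((1 - p) * (1 - r₁)) - (1 - r₂) * (1 - (1 - p) * (1 - r₁)) * (l2 + nn)) * b1 ≤ 0 := mul_nonpos_of_nonpos_of_nonneg (by linarith only [hB1]) hb1
  have t4 : (l2 * ((1 - p) * (1 - r₂)) - (1 - r₁) * (1 - (1 - p) * (1 - r₂)) * (l1 + nn)) * b2 ≤ 0 := mul_nonpos_of_nonpos_of_nonneg (by linarith only [hB2]) hb2
  have t5 : 0 ≤ (nn * p * (r₁ + r₂ * (1 - r₁) - max r₁ r₂) + l1 * (p * (r₂ * (1 - r₁))) + l2 * (p * (r₁ * (1 - r₂)))) * a0 := by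
    rw [hmx]
    exact mul_nonneg (add_nonneg (add_nonneg (mul_nonneg (mul_nonneg hn0 hp0) hmn) (mul_nonneg hl1 (mul_nonneg hp0 (mul_nonneg hr20 (sub_nonneg.2 hr11)))))
      (mul_nonneg hl2 (mul_nonneg hp0 (mul_nonneg hr10 (sub_nonneg.2 hr21))))) ha0
  have t6 : 0 ≤ (l1 * (1 - p * r₁) + l2 * (1 - p * r₂)) * a2 := mul_nonneg (add_nonneg (mul_nonneg hl1 (sub_nonneg.2 hpr1)) (mul_nonneg hl2 (sub_nonneg.2 hpr2))) ha2
  linarith only [hcomb, key, t1, t2, t3, t4, t5, t6]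


/-- **Crowd-plus, closed form** (g29): for `Δ = (1−p)² − s₁s₂ > 0` and `r₁, r₂ < 1` the weights `lᵢ = nn·sᵢmᵢ/((1−rᵢ)Δ)`
(`mᵢ = (1−p)(1−r₁r₂) + p(1−rᵢ)`) satisfy (B1), (B2) with equality, and (A), (C) become (A*), (C*). [this work] -/
theorem red8_crowdplus_star (p r₁ r₂ nn : ℝ) (hp0 : 0 ≤ p) (hp1 : p ≤ 1) (hr10 : 0 ≤ r₁) (hr11 : r₁ < 1) (hr20 : 0 ≤ r₂) (hr21 : r₂ < 1)
    (hn0 : 0 ≤ nn) (hD : 0 < ((1 - p) ^ 2 - (1 - (1 - p) * (1 - r₁)) * (1 - (1 - p) * (1 - r₂))))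
    (hA : (1 - p * max r₁ r₂ - nn * p * (1 - max r₁ r₂)) * ((1 - p) ^ 2 - (1 - (1 - p) * (1 - r₁)) * (1 - (1 - p) * (1 - r₂))) ≤ p * nn * ((1 - (1 - p) * (1 - r₁)) * ((1 - p) * (1 - r₁ * r₂) + p * (1 - r₁)) + (1 - (1 - p) * (1 - r₂)) * ((1 - p) * (1 - r₁ * r₂) + p * (1 - r₂))))
    (hC : (1 - p * (r₁ + r₂ * (1 - r₁)) - nn * p * ((1 - r₁) * (1 - r₂))) * ((1 - p) ^ 2 - (1 - (1 - p) * (1 - r₁)) * (1 - (1 - p) * (1 - r₂))) ≤ p * nn * ((1 - r₂) * (1 - (1 - p) * (1 - r₁)) * ((1 - p) * (1 - r₁ * r₂) + p * (1 - r₁)) + (1 - r₁) * (1 - (1 - p) * (1 - r₂)) * ((1 - p) * (1 - r₁ * r₂) + p * (1 - r₂)))) :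
    ∀ (a0 a1 a2 b1 b2 c0 c1 d : ℝ), 0 ≤ a0 → 0 ≤ a1 → 0 ≤ a2 → 0 ≤ b1 → 0 ≤ b2 → 0 ≤ c0 → 0 ≤ c1 → 0 ≤ d →
      b1 * (b2 + (c0 + c1)) ≤ (a0 + a1 + a2) * d →
      b2 * (b1 + (c0 + c1)) ≤ (a0 + a1 + a2) * d →
      (c0 + c1) * (b1 + b2) ≤ (a0 + a1 + a2) * d →
      b1 * (a1 + a2 + c1 + d) ≤ d * (a0 + b1 + b2 + c0) →
      b2 * (a1 + a2 + c1 + d) ≤ d * (a0 + b1 + b2 + c0) →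
      c0 * (a1 + a2 + c1 + d) ≤ (c1 + d) * (a0 + b1 + b2 + c0) →
      0 < p * ((1 - r₁) * (1 - r₂)) * (a0 + c0) - (1 - p) * a2 - (1 - p) * ((1 - r₁) * (1 - r₂)) * d →
      0 < (1 - p) * (1 - r₁) * b1 - p * (r₂ * (1 - r₁)) * a0 - p * (1 - r₁) * a1 - (1 - p * r₁) * a2 - (1 - (1 - p) * (1 - r₂)) * (1 - r₁) * b2 - p * ((1 - r₁) * (1 - r₂)) * c1 →
      0 < (1 - p) * (1 - r₂) * b2 - p * (r₁ * (1 - r₂)) * a0 - p * (1 - r₂) * a1 - (1 - p * r₂) * a2 - (1 - (1 - p) * (1 - r₁)) * (1 - r₂) * b1 - p * ((1 - r₁) * (1 - r₂)) * c1 →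
      0 < (1 - p * max r₁ r₂ - nn * p * (1 - max r₁ r₂)) * a1 + (1 - p * (r₁ + r₂ * (1 - r₁)) - nn * p * ((1 - r₁) * (1 - r₂))) * c1 - nn * p * (r₁ + r₂ * (1 - r₁) - max r₁ r₂) * a0 - nn * ((1 - (1 - p) * (1 - r₁)) * (1 - r₂)) * b1 - nn * ((1 - (1 - p) * (1 - r₂)) * (1 - r₁)) * b2 →
      0 < (p * (1 + r₁ + r₂ + nn * max r₁ r₂) - 2) * a0 + (p * (1 + r₁ + r₂) + p * max r₁ r₂ * (nn - 1) - 1) * a1 + (p * (1 + r₁ + r₂) + nn - 2) * a2 + ((1 - (1 - p) * (1 - r₁)) * (1 + r₂ * (nn + 1)) - 1) * b1 + ((1 - (1 - p) * (1 - r₂)) * (1 + r₁ * (nn + 1)) - 1) * b2 + (p * (1 + (nn + 2) * (r₁ + r₂ * (1 - r₁))) - 2) * c0 + (p * (1 + (nn + 1) * (r₁ + r₂ * (1 - r₁))) - 1) * c1 + (nn + 1 - (1 - p) * ((1 - r₁) * (1 - r₂))) * d →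
      False := by
  set D := ((1 - p) ^ 2 - (1 - (1 - p) * (1 - r₁)) * (1 - (1 - p) * (1 - r₂))) with hDdef
  set s₁ := (1 - (1 - p) * (1 - r₁)) with hs1
  set s₂ := (1 - (1 - p) * (1 - r₂)) with hs2
  set m₁ := ((1 - p) * (1 - r₁ * r₂) + p * (1 - r₁)) with hm1
  set m₂ := ((1 - p) * (1 - r₁ * r₂) + p * (1 - r₂)) with hm2
  have h1r : 0 < 1 - r₁ := by linarith only [hr11]
  have h2r : 0 < 1 - r₂ := by linarith only [hr21]
  have hs10 : 0 ≤ s₁ := by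
    have h := mul_nonneg hp0 (sub_nonneg.2 hr11.le)
    rw [hs1]; linarith only [h, hr10]
  have hs20 : 0 ≤ s₂ := by
    have h := mul_nonneg hp0 (sub_nonneg.2 hr21.le)
    rw [hs2]; linarith only [h, hr20]
  have hrr : r₁ * r₂ ≤ 1 := by
    have h := mul_le_mul hr11.le hr21.le hr20 zero_le_one
    linarith only [h]
  have hm10 : 0 ≤ m₁ := by
    have h1 := mul_nonneg (sub_nonneg.2 hp1) (sub_nonneg.2 hrr)
    have h2 := mul_nonneg hp0 (sub_nonneg.2 hr11.le)
    rw [hm1]; linarith only [h1, h2]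
  have hm20 : 0 ≤ m₂ := by
    have h1 := mul_nonneg (sub_nonneg.2 hp1) (sub_nonneg.2 hrr)
    have h2 := mul_nonneg hp0 (sub_nonneg.2 hr21.le)
    rw [hm2]; linarith only [h1, h2]
  have hDne : D ≠ 0 := ne_of_gt hD
  have h1ne : (1 - r₁) ≠ 0 := ne_of_gt h1r
  have h2ne : (1 - r₂) ≠ 0 := ne_of_gt h2r
  have key1 : m₁ * (1 - p) = s₂ * m₂ + (1 - r₂) * D := by rw [hm1, hm2, hDdef, hs1, hs2]; ring
  have key2 : m₂ * (1 - p) = s₁ * m₁ + (1 - r₁) * D := by rw [hm1, hm2, hDdef, hs1, hs2]; ring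
  refine red8_crowdplus p r₁ r₂ nn (nn * s₁ * m₁ / ((1 - r₁) * D)) (nn * s₂ * m₂ / ((1 - r₂) * D)) hp0 hp1 hr10 hr11.le hr20 hr21.le hn0
    (by positivity) (by positivity) ?_ ?_ ?_ ?_
  · have e : p * (nn * s₁ * m₁ / ((1 - r₁) * D) * (1 - r₁) + nn * s₂ * m₂ / ((1 - r₂) * D) * (1 - r₂)) = p * nn * (s₁ * m₁ + s₂ * m₂) / D := by
      field_simp
    rw [e, le_div_iff₀ hD]
    exact hA
  · have e : p * ((1 - r₁) * (1 - r₂)) * (nn * s₁ * m₁ / ((1 - r₁) * D) + nn * s₂ * m₂ / ((1 - r₂) * D)) = p * nn * ((1 - r₂) * s₁ * m₁ + (1 - r₁) * s₂ * m₂) / D := by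
      field_simp
    rw [e, le_div_iff₀ hD]
    exact hC
  · have eL : nn * s₁ * m₁ / ((1 - r₁) * D) * ((1 - p) * (1 - r₁)) = nn * s₁ * (m₁ * (1 - p)) / D := by
      field_simp
    have eR : (1 - r₂) * s₁ * (nn * s₂ * m₂ / ((1 - r₂) * D) + nn) = nn * s₁ * (s₂ * m₂ + (1 - r₂) * D) / D := by
      field_simp
    rw [eL, eR, key1]
  · have eL : nn * s₂ * m₂ / ((1 - r₂) * D) * ((1 - p) * (1 - r₂)) = nn * s₂ * (m₂ * (1 - p)) / D := by
      field_simp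
    have eR : (1 - r₁) * s₂ * (nn * s₁ * m₁ / ((1 - r₁) * D) + nn) = nn * s₂ * (s₁ * m₁ + (1 - r₁) * D) / D := by
      field_simp
    rw [eL, eR, key2]


/-- **The crowd-plus threshold inequality for `p ≥ 1/3`**: `(1−p)·Δ ≤ p·((1−r₂)s₁m₁ + (1−r₁)s₂m₂)` on `[1/3,1] × [0,1]²`
(tight exactly at `(1/3, 0, 0)`), by an explicit 21-term Handelman certificate (products of `p − 1/3, 1 − p, rᵢ, 1 − rᵢ`). [this work] -/
theorem G_third (p r₁ r₂ : ℝ) (hp : 1 / 3 ≤ p) (hp1 : p ≤ 1) (hr10 : 0 ≤ r₁) (hr11 : r₁ ≤ 1) (hr20 : 0 ≤ r₂) (hr21 : r₂ ≤ 1) :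
    (1 - p) * ((1 - p) ^ 2 - (1 - (1 - p) * (1 - r₁)) * (1 - (1 - p) * (1 - r₂))) ≤ p * ((1 - r₂) * (1 - (1 - p) * (1 - r₁)) * ((1 - p) * (1 - r₁ * r₂) + p * (1 - r₁)) + (1 - r₁) * (1 - (1 - p) * (1 - r₂)) * ((1 - p) * (1 - r₁ * r₂) + p * (1 - r₂))) := by
  have hq : 0 ≤ (p - 1 / 3) := by linarith only [hp]
  have hq' : 0 ≤ (1 - p) := by linarith only [hp1]
  have hr11' : 0 ≤ (1 - r₁) := by linarith only [hr11]
  have hr21' : 0 ≤ (1 - r₂) := by linarith only [hr21]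
  have key : p * ((1 - r₂) * (1 - (1 - p) * (1 - r₁)) * ((1 - p) * (1 - r₁ * r₂) + p * (1 - r₁)) + (1 - r₁) * (1 - (1 - p) * (1 - r₂)) * ((1 - p) * (1 - r₁ * r₂) + p * (1 - r₂))) - (1 - p) * ((1 - p) ^ 2 - (1 - (1 - p) * (1 - r₁)) * (1 - (1 - p) * (1 - r₂)))
      = (2 / 9 : ℝ) * (p - 1 / 3) ^ 0 * (1 - p) ^ 0 * r₁ ^ 0 * (1 - r₁) ^ 1 * r₂ ^ 1 * (1 - r₂) ^ 1
        + (2 / 9 : ℝ) * (p - 1 / 3) ^ 0 * (1 - p) ^ 0 * r₁ ^ 1 * (1 - r₁) ^ 1 * r₂ ^ 0 * (1 - r₂) ^ 1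
        + (2 / 9 : ℝ) * (p - 1 / 3) ^ 0 * (1 - p) ^ 0 * r₁ ^ 1 * (1 - r₁) ^ 1 * r₂ ^ 1 * (1 - r₂) ^ 1
        + (1 / 9 : ℝ) * (p - 1 / 3) ^ 0 * (1 - p) ^ 1 * r₁ ^ 0 * (1 - r₁) ^ 2 * r₂ ^ 2 * (1 - r₂) ^ 0
        + (1 / 6 : ℝ) * (p - 1 / 3) ^ 0 * (1 - p) ^ 2 * r₁ ^ 0 * (1 - r₁) ^ 0 * r₂ ^ 2 * (1 - r₂) ^ 0
        + (1 / 3 : ℝ) * (p - 1 / 3) ^ 0 * (1 - p) ^ 2 * r₁ ^ 2 * (1 - r₁) ^ 0 * r₂ ^ 0 * (1 - r₂) ^ 0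
        + (1 / 2 : ℝ) * (p - 1 / 3) ^ 0 * (1 - p) ^ 3 * r₁ ^ 1 * (1 - r₁) ^ 0 * r₂ ^ 2 * (1 - r₂) ^ 0
        + 2 * (p - 1 / 3) ^ 1 * (1 - p) ^ 0 * r₁ ^ 0 * (1 - r₁) ^ 1 * r₂ ^ 0 * (1 - r₂) ^ 1
        + (2 / 9 : ℝ) * (p - 1 / 3) ^ 1 * (1 - p) ^ 0 * r₁ ^ 0 * (1 - r₁) ^ 2 * r₂ ^ 1 * (1 - r₂) ^ 1
        + (1 / 9 : ℝ) * (p - 1 / 3) ^ 1 * (1 - p) ^ 0 * r₁ ^ 1 * (1 - r₁) ^ 1 * r₂ ^ 0 * (1 - r₂) ^ 2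
        + (3 / 2 : ℝ) * (p - 1 / 3) ^ 1 * (1 - p) ^ 1 * r₁ ^ 0 * (1 - r₁) ^ 0 * r₂ ^ 0 * (1 - r₂) ^ 0
        + 1 * (p - 1 / 3) ^ 1 * (1 - p) ^ 1 * r₁ ^ 0 * (1 - r₁) ^ 2 * r₂ ^ 1 * (1 - r₂) ^ 0
        + (1 / 3 : ℝ) * (p - 1 / 3) ^ 1 * (1 - p) ^ 1 * r₁ ^ 0 * (1 - r₁) ^ 2 * r₂ ^ 2 * (1 - r₂) ^ 0
        + (3 / 2 : ℝ) * (p - 1 / 3) ^ 1 * (1 - p) ^ 1 * r₁ ^ 1 * (1 - r₁) ^ 0 * r₂ ^ 0 * (1 - r₂) ^ 2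
        + 1 * (p - 1 / 3) ^ 1 * (1 - p) ^ 2 * r₁ ^ 0 * (1 - r₁) ^ 0 * r₂ ^ 1 * (1 - r₂) ^ 0
        + (1 / 2 : ℝ) * (p - 1 / 3) ^ 1 * (1 - p) ^ 2 * r₁ ^ 1 * (1 - r₁) ^ 0 * r₂ ^ 0 * (1 - r₂) ^ 0
        + (1 / 2 : ℝ) * (p - 1 / 3) ^ 1 * (1 - p) ^ 2 * r₁ ^ 2 * (1 - r₁) ^ 0 * r₂ ^ 0 * (1 - r₂) ^ 2
        + (5 / 6 : ℝ) * (p - 1 / 3) ^ 2 * (1 - p) ^ 0 * r₁ ^ 0 * (1 - r₁) ^ 1 * r₂ ^ 0 * (1 - r₂) ^ 2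
        + (2 / 3 : ℝ) * (p - 1 / 3) ^ 2 * (1 - p) ^ 0 * r₁ ^ 0 * (1 - r₁) ^ 2 * r₂ ^ 0 * (1 - r₂) ^ 1
        + 1 * (p - 1 / 3) ^ 2 * (1 - p) ^ 1 * r₁ ^ 0 * (1 - r₁) ^ 2 * r₂ ^ 1 * (1 - r₂) ^ 1
        + (1 / 2 : ℝ) * (p - 1 / 3) ^ 2 * (1 - p) ^ 1 * r₁ ^ 1 * (1 - r₁) ^ 1 * r₂ ^ 0 * (1 - r₂) ^ 2 := by ring

  have w0 : 0 ≤ (2 / 9 : ℝ) * (p - 1 / 3) ^ 0 * (1 - p) ^ 0 * r₁ ^ 0 * (1 - r₁) ^ 1 * r₂ ^ 1 * (1 - r₂) ^ 1 := mul_nonneg (mul_nonneg (mul_nonneg (mul_nonneg (mul_nonneg (mul_nonneg ((by norm_num : (0 : ℝ) ≤ (2 / 9 : ℝ))) (pow_nonneg hq 0)) (pow_nonneg hq' 0)) (pow_nonneg hr10 0)) (pow_nonneg hr11' 1)) (pow_nonneg hr20 1)) (pow_nonneg hr21' 1)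
  have w1 : 0 ≤ (2 / 9 : ℝ) * (p - 1 / 3) ^ 0 * (1 - p) ^ 0 * r₁ ^ 1 * (1 - r₁) ^ 1 * r₂ ^ 0 * (1 - r₂) ^ 1 := mul_nonneg (mul_nonneg (mul_nonneg (mul_nonneg (mul_nonneg (mul_nonneg ((by norm_num : (0 : ℝ) ≤ (2 / 9 : ℝ))) (pow_nonneg hq 0)) (pow_nonneg hq' 0)) (pow_nonneg hr10 1)) (pow_nonneg hr11' 1)) (pow_nonneg hr20 0)) (pow_nonneg hr21' 1)
  have w2 : 0 ≤ (2 / 9 : ℝ) * (p - 1 / 3) ^ 0 * (1 - p) ^ 0 * r₁ ^ 1 * (1 - r₁) ^ 1 * r₂ ^ 1 * (1 - r₂) ^ 1 := mul_nonneg (mul_nonneg (mul_nonneg (mul_nonneg (mul_nonneg (mul_nonneg ((by norm_num : (0 : ℝ) ≤ (2 / 9 : ℝ))) (pow_nonneg hq 0)) (pow_nonneg hq' 0)) (pow_nonneg hr10 1)) (pow_nonneg hr11' 1)) (pow_nonneg hr20 1)) (pow_nonneg hr21' 1)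
  have w3 : 0 ≤ (1 / 9 : ℝ) * (p - 1 / 3) ^ 0 * (1 - p) ^ 1 * r₁ ^ 0 * (1 - r₁) ^ 2 * r₂ ^ 2 * (1 - r₂) ^ 0 := mul_nonneg (mul_nonneg (mul_nonneg (mul_nonneg (mul_nonneg (mul_nonneg ((by norm_num : (0 : ℝ) ≤ (1 / 9 : ℝ))) (pow_nonneg hq 0)) (pow_nonneg hq' 1)) (pow_nonneg hr10 0)) (pow_nonneg hr11' 2)) (pow_nonneg hr20 2)) (pow_nonneg hr21' 0)
  have w4 : 0 ≤ (1 / 6 : ℝ) * (p - 1 / 3) ^ 0 * (1 - p) ^ 2 * r₁ ^ 0 * (1 - r₁) ^ 0 * r₂ ^ 2 * (1 - r₂) ^ 0 := mul_nonneg (mul_nonneg (mul_nonneg (mul_nonneg (mul_nonneg (mul_nonneg ((by norm_num : (0 : ℝ) ≤ (1 / 6 : ℝ))) (pow_nonneg hq 0)) (pow_nonneg hq' 2)) (pow_nonneg hr10 0)) (pow_nonneg hr11' 0)) (pow_nonneg hr20 2)) (pow_nonneg hr21' 0)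
  have w5 : 0 ≤ (1 / 3 : ℝ) * (p - 1 / 3) ^ 0 * (1 - p) ^ 2 * r₁ ^ 2 * (1 - r₁) ^ 0 * r₂ ^ 0 * (1 - r₂) ^ 0 := mul_nonneg (mul_nonneg (mul_nonneg (mul_nonneg (mul_nonneg (mul_nonneg ((by norm_num : (0 : ℝ) ≤ (1 / 3 : ℝ))) (pow_nonneg hq 0)) (pow_nonneg hq' 2)) (pow_nonneg hr10 2)) (pow_nonneg hr11' 0)) (pow_nonneg hr20 0)) (pow_nonneg hr21' 0)
  have w6 : 0 ≤ (1 / 2 : ℝ) * (p - 1 / 3) ^ 0 * (1 - p) ^ 3 * r₁ ^ 1 * (1 - r₁) ^ 0 * r₂ ^ 2 * (1 - r₂) ^ 0 := mul_nonneg (mul_nonneg (mul_nonneg (mul_nonneg (mul_nonneg (mul_nonneg ((by norm_num : (0 : ℝ) ≤ (1 / 2 : ℝ))) (pow_nonneg hq 0)) (pow_nonneg hq' 3)) (pow_nonneg hr10 1)) (pow_nonneg hr11' 0)) (pow_nonneg hr20 2)) (pow_nonneg hr21' 0)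
  have w7 : 0 ≤ 2 * (p - 1 / 3) ^ 1 * (1 - p) ^ 0 * r₁ ^ 0 * (1 - r₁) ^ 1 * r₂ ^ 0 * (1 - r₂) ^ 1 := mul_nonneg (mul_nonneg (mul_nonneg (mul_nonneg (mul_nonneg (mul_nonneg ((by norm_num : (0 : ℝ) ≤ 2)) (pow_nonneg hq 1)) (pow_nonneg hq' 0)) (pow_nonneg hr10 0)) (pow_nonneg hr11' 1)) (pow_nonneg hr20 0)) (pow_nonneg hr21' 1)
  have w8 : 0 ≤ (2 / 9 : ℝ) * (p - 1 / 3) ^ 1 * (1 - p) ^ 0 * r₁ ^ 0 * (1 - r₁) ^ 2 * r₂ ^ 1 * (1 - r₂) ^ 1 := mul_nonneg (mul_nonneg (mul_nonneg (mul_nonneg (mul_nonneg (mul_nonneg ((by norm_num : (0 : ℝ) ≤ (2 / 9 : ℝ))) (pow_nonneg hq 1)) (pow_nonneg hq' 0)) (pow_nonneg hr10 0)) (pow_nonneg hr11' 2)) (pow_nonneg hr20 1)) (pow_nonneg hr21' 1)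
  have w9 : 0 ≤ (1 / 9 : ℝ) * (p - 1 / 3) ^ 1 * (1 - p) ^ 0 * r₁ ^ 1 * (1 - r₁) ^ 1 * r₂ ^ 0 * (1 - r₂) ^ 2 := mul_nonneg (mul_nonneg (mul_nonneg (mul_nonneg (mul_nonneg (mul_nonneg ((by norm_num : (0 : ℝ) ≤ (1 / 9 : ℝ))) (pow_nonneg hq 1)) (pow_nonneg hq' 0)) (pow_nonneg hr10 1)) (pow_nonneg hr11' 1)) (pow_nonneg hr20 0)) (pow_nonneg hr21' 2)
  have w10 : 0 ≤ (3 / 2 : ℝ) * (p - 1 / 3) ^ 1 * (1 - p) ^ 1 * r₁ ^ 0 * (1 - r₁) ^ 0 * r₂ ^ 0 * (1 - r₂) ^ 0 := mul_nonneg (mul_nonneg (mul_nonneg (mul_nonneg (mul_nonneg (mul_nonneg ((by norm_num : (0 : ℝ) ≤ (3 / 2 : ℝ))) (pow_nonneg hq 1)) (pow_nonneg hq' 1)) (pow_nonneg hr10 0)) (pow_nonneg hr11' 0)) (pow_nonneg hr20 0)) (pow_nonneg hr21' 0)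
  have w11 : 0 ≤ 1 * (p - 1 / 3) ^ 1 * (1 - p) ^ 1 * r₁ ^ 0 * (1 - r₁) ^ 2 * r₂ ^ 1 * (1 - r₂) ^ 0 := mul_nonneg (mul_nonneg (mul_nonneg (mul_nonneg (mul_nonneg (mul_nonneg ((by norm_num : (0 : ℝ) ≤ 1)) (pow_nonneg hq 1)) (pow_nonneg hq' 1)) (pow_nonneg hr10 0)) (pow_nonneg hr11' 2)) (pow_nonneg hr20 1)) (pow_nonneg hr21' 0)
  have w12 : 0 ≤ (1 / 3 : ℝ) * (p - 1 / 3) ^ 1 * (1 - p) ^ 1 * r₁ ^ 0 * (1 - r₁) ^ 2 * r₂ ^ 2 * (1 - r₂) ^ 0 := mul_nonneg (mul_nonneg (mul_nonneg (mul_nonneg (mul_nonneg (mul_nonneg ((by norm_num : (0 : ℝ) ≤ (1 / 3 : ℝ))) (pow_nonneg hq 1)) (pow_nonneg hq' 1)) (pow_nonneg hr10 0)) (pow_nonneg hr11' 2)) (pow_nonneg hr20 2)) (pow_nonneg hr21' 0)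
  have w13 : 0 ≤ (3 / 2 : ℝ) * (p - 1 / 3) ^ 1 * (1 - p) ^ 1 * r₁ ^ 1 * (1 - r₁) ^ 0 * r₂ ^ 0 * (1 - r₂) ^ 2 := mul_nonneg (mul_nonneg (mul_nonneg (mul_nonneg (mul_nonneg (mul_nonneg ((by norm_num : (0 : ℝ) ≤ (3 / 2 : ℝ))) (pow_nonneg hq 1)) (pow_nonneg hq' 1)) (pow_nonneg hr10 1)) (pow_nonneg hr11' 0)) (pow_nonneg hr20 0)) (pow_nonneg hr21' 2)
  have w14 : 0 ≤ 1 * (p - 1 / 3) ^ 1 * (1 - p) ^ 2 * r₁ ^ 0 * (1 - r₁) ^ 0 * r₂ ^ 1 * (1 - r₂) ^ 0 := mul_nonneg (mul_nonneg (mul_nonneg (mul_nonneg (mul_nonneg (mul_nonneg ((by norm_num : (0 : ℝ) ≤ 1)) (pow_nonneg hq 1)) (pow_nonneg hq' 2)) (pow_nonneg hr10 0)) (pow_nonneg hr11' 0)) (pow_nonneg hr20 1)) (pow_nonneg hr21' 0)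
  have w15 : 0 ≤ (1 / 2 : ℝ) * (p - 1 / 3) ^ 1 * (1 - p) ^ 2 * r₁ ^ 1 * (1 - r₁) ^ 0 * r₂ ^ 0 * (1 - r₂) ^ 0 := mul_nonneg (mul_nonneg (mul_nonneg (mul_nonneg (mul_nonneg (mul_nonneg ((by norm_num : (0 : ℝ) ≤ (1 / 2 : ℝ))) (pow_nonneg hq 1)) (pow_nonneg hq' 2)) (pow_nonneg hr10 1)) (pow_nonneg hr11' 0)) (pow_nonneg hr20 0)) (pow_nonneg hr21' 0)
  have w16 : 0 ≤ (1 / 2 : ℝ) * (p - 1 / 3) ^ 1 * (1 - p) ^ 2 * r₁ ^ 2 * (1 - r₁) ^ 0 * r₂ ^ 0 * (1 - r₂) ^ 2 := mul_nonneg (mul_nonneg (mul_nonneg (mul_nonneg (mul_nonneg (mul_nonneg ((by norm_num : (0 : ℝ) ≤ (1 / 2 : ℝ))) (pow_nonneg hq 1)) (pow_nonneg hq' 2)) (pow_nonneg hr10 2)) (pow_nonneg hr11' 0)) (pow_nonneg hr20 0)) (pow_nonneg hr21' 2)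
  have w17 : 0 ≤ (5 / 6 : ℝ) * (p - 1 / 3) ^ 2 * (1 - p) ^ 0 * r₁ ^ 0 * (1 - r₁) ^ 1 * r₂ ^ 0 * (1 - r₂) ^ 2 := mul_nonneg (mul_nonneg (mul_nonneg (mul_nonneg (mul_nonneg (mul_nonneg ((by norm_num : (0 : ℝ) ≤ (5 / 6 : ℝ))) (pow_nonneg hq 2)) (pow_nonneg hq' 0)) (pow_nonneg hr10 0)) (pow_nonneg hr11' 1)) (pow_nonneg hr20 0)) (pow_nonneg hr21' 2)
  have w18 : 0 ≤ (2 / 3 : ℝ) * (p - 1 / 3) ^ 2 * (1 - p) ^ 0 * r₁ ^ 0 * (1 - r₁) ^ 2 * r₂ ^ 0 * (1 - r₂) ^ 1 := mul_nonneg (mul_nonneg (mul_nonneg (mul_nonneg (mul_nonneg (mul_nonneg ((by norm_num : (0 : ℝ) ≤ (2 / 3 : ℝ))) (pow_nonneg hq 2)) (pow_nonneg hq' 0)) (pow_nonneg hr10 0)) (pow_nonneg hr11' 2)) (pow_nonneg hr20 0)) (pow_nonneg hr21' 1)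
  have w19 : 0 ≤ 1 * (p - 1 / 3) ^ 2 * (1 - p) ^ 1 * r₁ ^ 0 * (1 - r₁) ^ 2 * r₂ ^ 1 * (1 - r₂) ^ 1 := mul_nonneg (mul_nonneg (mul_nonneg (mul_nonneg (mul_nonneg (mul_nonneg ((by norm_num : (0 : ℝ) ≤ 1)) (pow_nonneg hq 2)) (pow_nonneg hq' 1)) (pow_nonneg hr10 0)) (pow_nonneg hr11' 2)) (pow_nonneg hr20 1)) (pow_nonneg hr21' 1)
  have w20 : 0 ≤ (1 / 2 : ℝ) * (p - 1 / 3) ^ 2 * (1 - p) ^ 1 * r₁ ^ 1 * (1 - r₁) ^ 1 * r₂ ^ 0 * (1 - r₂) ^ 2 := mul_nonneg (mul_nonneg (mul_nonneg (mul_nonneg (mul_nonneg (mul_nonneg ((by norm_num : (0 : ℝ) ≤ (1 / 2 : ℝ))) (pow_nonneg hq 2)) (pow_nonneg hq' 1)) (pow_nonneg hr10 1)) (pow_nonneg hr11' 1)) (pow_nonneg hr20 0)) (pow_nonneg hr21' 2)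
  linarith only [key, w0, w1, w2, w3, w4, w5, w6, w7, w8, w9, w10, w11, w12, w13, w14, w15, w16, w17, w18, w19, w20]

/-- **The 8-cell cover lemma for `p ≥ 1/3`** (all `r₁, r₂ ∈ [0,1]`, `nn ≥ 1`): edges / coupled / crowd-plus via `G_third`. [this work] -/
theorem red8_third (p r₁ r₂ nn : ℝ) (hp : 1 / 3 ≤ p) (hp1 : p ≤ 1) (hr10 : 0 ≤ r₁) (hr11 : r₁ ≤ 1) (hr20 : 0 ≤ r₂) (hr21 : r₂ ≤ 1) (hn : 1 ≤ nn) :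
    ∀ (a0 a1 a2 b1 b2 c0 c1 d : ℝ), 0 ≤ a0 → 0 ≤ a1 → 0 ≤ a2 → 0 ≤ b1 → 0 ≤ b2 → 0 ≤ c0 → 0 ≤ c1 → 0 ≤ d →
      b1 * (b2 + (c0 + c1)) ≤ (a0 + a1 + a2) * d →
      b2 * (b1 + (c0 + c1)) ≤ (a0 + a1 + a2) * d →
      (c0 + c1) * (b1 + b2) ≤ (a0 + a1 + a2) * d →
      b1 * (a1 + a2 + c1 + d) ≤ d * (a0 + b1 + b2 + c0) →
      b2 * (a1 + a2 + c1 + d) ≤ d * (a0 + b1 + b2 + c0) →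
      c0 * (a1 + a2 + c1 + d) ≤ (c1 + d) * (a0 + b1 + b2 + c0) →
      0 < p * ((1 - r₁) * (1 - r₂)) * (a0 + c0) - (1 - p) * a2 - (1 - p) * ((1 - r₁) * (1 - r₂)) * d →
      0 < (1 - p) * (1 - r₁) * b1 - p * (r₂ * (1 - r₁)) * a0 - p * (1 - r₁) * a1 - (1 - p * r₁) * a2 - (1 - (1 - p) * (1 - r₂)) * (1 - r₁) * b2 - p * ((1 - r₁) * (1 - r₂)) * c1 →
      0 < (1 - p) * (1 - r₂) * b2 - p * (r₁ * (1 - r₂)) * a0 - p * (1 - r₂) * a1 - (1 - p * r₂) * a2 - (1 - (1 - p) * (1 - r₁)) * (1 - r₂) * b1 - p * ((1 - r₁) * (1 - r₂)) * c1 →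
      0 < (1 - p * max r₁ r₂ - nn * p * (1 - max r₁ r₂)) * a1 + (1 - p * (r₁ + r₂ * (1 - r₁)) - nn * p * ((1 - r₁) * (1 - r₂))) * c1 - nn * p * (r₁ + r₂ * (1 - r₁) - max r₁ r₂) * a0 - nn * ((1 - (1 - p) * (1 - r₁)) * (1 - r₂)) * b1 - nn * ((1 - (1 - p) * (1 - r₂)) * (1 - r₁)) * b2 →
      0 < (p * (1 + r₁ + r₂ + nn * max r₁ r₂) - 2) * a0 + (p * (1 + r₁ + r₂) + p * max r₁ r₂ * (nn - 1) - 1) * a1 + (p * (1 + r₁ + r₂) + nn - 2) * a2 + ((1 - (1 - p) * (1 - r₁)) * (1 + r₂ * (nn + 1)) - 1) * b1 + ((1 - (1 - p) * (1 - r₂)) * (1 + r₁ * (nn + 1)) - 1) * b2 + (p * (1 + (nn + 2) * (r₁ + r₂ * (1 - r₁))) - 2) * c0 + (p * (1 + (nn + 1) * (r₁ + r₂ * (1 - r₁))) - 1) * c1 + (nn + 1 - (1 - p) * ((1 - r₁) * (1 - r₂))) * d →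
      False := by
  have hp0 : 0 ≤ p := by linarith only [hp]
  rcases eq_or_lt_of_le hr11 with h1 | h1
  · exact red8_edge p r₁ r₂ nn hp0 hp1 hr10 hr11 hr20 hr21 (Or.inl h1)
  rcases eq_or_lt_of_le hr21 with h2 | h2
  · exact red8_edge p r₁ r₂ nn hp0 hp1 hr10 hr11 hr20 hr21 (Or.inr (Or.inl h2))
  rcases eq_or_lt_of_le hp1 with h3 | h3
  · exact red8_edge p r₁ r₂ nn hp0 hp1 hr10 hr11 hr20 hr21 (Or.inr (Or.inr h3))
  rcases le_or_gt ((1 - p) ^ 2 - (1 - (1 - p) * (1 - r₁)) * (1 - (1 - p) * (1 - r₂))) 0 with hD | hD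
  · exact red8_coupled p r₁ r₂ nn hp0 h3 hr10 h1 hr20 hr21 hD
  have hn0 : 0 ≤ nn := by linarith only [hn]
  have hG := G_third p r₁ r₂ hp hp1 hr10 hr11 hr20 hr21
  have hs1 : 0 ≤ (1 - (1 - p) * (1 - r₁)) := by nlinarith only [hp0, hp1, hr10, hr11]
  have hs2 : 0 ≤ (1 - (1 - p) * (1 - r₂)) := by nlinarith only [hp0, hp1, hr20, hr21]
  have hrr : r₁ * r₂ ≤ 1 := by nlinarith only [hr10, hr11, hr20, hr21]
  have hm1 : 0 ≤ ((1 - p) * (1 - r₁ * r₂) + p * (1 - r₁)) := by nlinarith only [hp0, hp1, hrr, hr11]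
  have hm2 : 0 ≤ ((1 - p) * (1 - r₁ * r₂) + p * (1 - r₂)) := by nlinarith only [hp0, hp1, hrr, hr21]
  have hsm1 : 0 ≤ (1 - (1 - p) * (1 - r₁)) * ((1 - p) * (1 - r₁ * r₂) + p * (1 - r₁)) := mul_nonneg hs1 hm1
  have hsm2 : 0 ≤ (1 - (1 - p) * (1 - r₂)) * ((1 - p) * (1 - r₁ * r₂) + p * (1 - r₂)) := mul_nonneg hs2 hm2
  have hXC : 0 ≤ ((1 - r₂) * (1 - (1 - p) * (1 - r₁)) * ((1 - p) * (1 - r₁ * r₂) + p * (1 - r₁)) + (1 - r₁) * (1 - (1 - p) * (1 - r₂)) * ((1 - p) * (1 - r₁ * r₂) + p * (1 - r₂))) := add_nonneg (mul_nonneg (mul_nonneg (sub_nonneg.2 hr21) hs1) hm1) (mul_nonneg (mul_nonneg (sub_nonneg.2 hr11) hs2) hm2)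
  have hXCA : ((1 - r₂) * (1 - (1 - p) * (1 - r₁)) * ((1 - p) * (1 - r₁ * r₂) + p * (1 - r₁)) + (1 - r₁) * (1 - (1 - p) * (1 - r₂)) * ((1 - p) * (1 - r₁ * r₂) + p * (1 - r₂))) ≤ ((1 - (1 - p) * (1 - r₁)) * ((1 - p) * (1 - r₁ * r₂) + p * (1 - r₁)) + (1 - (1 - p) * (1 - r₂)) * ((1 - p) * (1 - r₁ * r₂) + p * (1 - r₂))) := by nlinarith only [hsm1, hsm2, hr10, hr20]
  have hmax1 : max r₁ r₂ ≤ 1 := max_le hr11 hr21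
  have hka : (1 - p * max r₁ r₂ - nn * p * (1 - max r₁ r₂)) ≤ 1 - p := by nlinarith only [mul_nonneg (mul_nonneg (sub_nonneg.2 hn) hp0) (sub_nonneg.2 hmax1)]
  have hkc : (1 - p * (r₁ + r₂ * (1 - r₁)) - nn * p * ((1 - r₁) * (1 - r₂))) ≤ 1 - p := by
    have e : 1 - p * (r₁ + r₂ * (1 - r₁)) - nn * p * ((1 - r₁) * (1 - r₂)) = (1 - p) - (nn - 1) * p * ((1 - r₁) * (1 - r₂)) := by ring
    rw [e]; nlinarith only [mul_nonneg (mul_nonneg (sub_nonneg.2 hn) hp0) (mul_nonneg (sub_nonneg.2 hr11) (sub_nonneg.2 hr21))]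
  refine red8_crowdplus_star p r₁ r₂ nn hp0 hp1 hr10 h1 hr20 h2 hn0 hD ?_ ?_
  · have a1 : (1 - p * max r₁ r₂ - nn * p * (1 - max r₁ r₂)) * ((1 - p) ^ 2 - (1 - (1 - p) * (1 - r₁)) * (1 - (1 - p) * (1 - r₂))) ≤ (1 - p) * ((1 - p) ^ 2 - (1 - (1 - p) * (1 - r₁)) * (1 - (1 - p) * (1 - r₂))) := mul_le_mul_of_nonneg_right hka hD.le
    have a2 : p * ((1 - r₂) * (1 - (1 - p) * (1 - r₁)) * ((1 - p) * (1 - r₁ * r₂) + p * (1 - r₁)) + (1 - r₁) * (1 - (1 - p) * (1 - r₂)) * ((1 - p) * (1 - r₁ * r₂) + p * (1 - r₂))) ≤ p * nn * ((1 - (1 - p) * (1 - r₁)) * ((1 - p) * (1 - r₁ * r₂) + p * (1 - r₁)) + (1 - (1 - p) * (1 - r₂)) * ((1 - p) * (1 - r₁ * r₂) + p * (1 - r₂))) := by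
      have u := mul_nonneg hp0 (mul_nonneg (sub_nonneg.2 hn) (le_trans hXC hXCA))
      have v := mul_nonneg hp0 (sub_nonneg.2 hXCA)
      nlinarith only [u, v]
    linarith only [a1, hG, a2]
  · have c1 : (1 - p * (r₁ + r₂ * (1 - r₁)) - nn * p * ((1 - r₁) * (1 - r₂))) * ((1 - p) ^ 2 - (1 - (1 - p) * (1 - r₁)) * (1 - (1 - p) * (1 - r₂))) ≤ (1 - p) * ((1 - p) ^ 2 - (1 - (1 - p) * (1 - r₁)) * (1 - (1 - p) * (1 - r₂))) := mul_le_mul_of_nonneg_right hkc hD.le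
    have c2 : p * ((1 - r₂) * (1 - (1 - p) * (1 - r₁)) * ((1 - p) * (1 - r₁ * r₂) + p * (1 - r₁)) + (1 - r₁) * (1 - (1 - p) * (1 - r₂)) * ((1 - p) * (1 - r₁ * r₂) + p * (1 - r₂))) ≤ p * nn * ((1 - r₂) * (1 - (1 - p) * (1 - r₁)) * ((1 - p) * (1 - r₁ * r₂) + p * (1 - r₁)) + (1 - r₁) * (1 - (1 - p) * (1 - r₂)) * ((1 - p) * (1 - r₁ * r₂) + p * (1 - r₂))) := by
      have u := mul_nonneg hp0 (mul_nonneg (sub_nonneg.2 hn) hXC)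
      nlinarith only [u]
    linarith only [c1, hG, c2]

end Gate3

end Quant

end Summit.CriticalPhenomena.PercolationContinuityZ3.Theorems
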